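import Mathlib
import Summits.NavierStokesRegularity.NavierStokesRegularity.Theorems.LevelSetModerationHighSpeedPressureWorkFastSetGradientBricks
import Literature.Analysis.UnboundedOperators.HeatKernelBernsteinVector

/-!
# Route LevelSetModeration — `HighSpeedPressureWork`: overshoot × Frobenius gradient on the fast set, unit form

Support file for item stmt-NavierStokesRegularity-18149 (`HighSpeedPressureWork`), line
`iso-speed-area-closure`, stub `stub_earlyBookkeeping` (margin-zero early law) in its anatomy
`EarlyBookkeeping ↔ EarlySliceLaw ∧ EarlyRotationLaw` (`…EarlyAnatomyTools`, lead c1). The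
ROTATION term of the exact level-set balance,
`R_c(t) = ∫₀ᵗ∫ 1_{|u|>c} (1 - c/|u|)(|∇u|²_F - |∇|u||²)`, carries the FULL gradient `|∇u|_F`,
whose class-uniform rate in the early window is only parabolic, `B₀/√(ντ)`. On the FAST SET the
prefactor `1 - c/|u| ≤ (|u| - B₀)/B₀` is the overshoot, `≲ B₀ √(B₀²τ/ν)`, and at a fast point the
caloric part of the mild formula is near-extremal, so the vector Bernstein (variance) inequality
`2s |∇e^{sΔ}f|²_F ≤ B² - |e^{sΔ}f|²` (`two_mul_mul_sum_sq_norm_fderiv_heatExtension_le`) gives the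
IMPROVED rate `|∇u|²_F ≲ B₀³ ν^{-3/2} τ^{-1/2}` there; the two powers of `τ` cancel:

  `(|u(τ,x)| - B₀) · |∇u(τ,x)|²_F ≤ A B₀⁵/ν²`  on `{|u(τ)| > B₀}`, `τ ≤ ε ν/B₀²`,

whence the LINEAR ROTATION LAW `ν R_c(t) ≤ (A B₀⁴/ν) V_c(t)` at margin zero (class form and the
law in `…FastSetFrobenius.lean`). This file proves the unit form (`ν = 1`, speed `≤ 1`).

Mechanism (all bricks landed): mild formula from `s = τ/2` (`mild_of_bounded_of_eLpNorm_two_le_of_lt`);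
overshoot bound `|u(s)| ≤ B + C₃√s` (`exists_norm_le_initial_add_of_classical_unit`); Duhamel sup
bound (`exists_norm_oseenDuhamel_le_mul`) and bounded Duhamel gradient
(`levelSetModeration_norm_fderiv_oseenDuhamel_le_unit`); vector Bernstein inequality for the
caloric part at the fast point, where `B_s² - |e^{(τ-s)Δ}u(s)(x)|² ≲ √τ` by fastness.
-/

noncomputable section

-- single-conjunct summit: `Summit.<Summit>.<Problem>` repeats the name by the D-0017 layout
set_option linter.dupNamespace false

namespace Summit.NavierStokesRegularity.NavierStokesRegularity.Theorems

open MeasureTheory Set Filter Topology Function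
open scoped ENNReal RealInnerProductSpace
open Literature.Analysis.FluidPDE
open Literature.Analysis.UnboundedOperators (heatExtension heatKernel heatExtension_apply
  contDiff_heatExtension_holds memLp_top_of_continuous_of_bound
  two_mul_mul_sum_sq_norm_fderiv_heatExtension_le)

/-! ### Frobenius algebra -/

/-- `|A - B|²_F ≤ 2|A|²_F + 2|B|²_F`. [folklore] -/
theorem fastSet_frobeniusNormSq_sub_le {E F : Type*} [NormedAddCommGroup E] [InnerProductSpace ℝ E]
    [FiniteDimensional ℝ E] [NormedAddCommGroup F] [InnerProductSpace ℝ F]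
    (A B : E →L[ℝ] F) :
    frobeniusNormSq (A - B) ≤ 2 * frobeniusNormSq A + 2 * frobeniusNormSq B := by
  unfold frobeniusNormSq
  rw [Finset.mul_sum, Finset.mul_sum, ← Finset.sum_add_distrib]
  refine Finset.sum_le_sum fun i _ => ?_
  rw [show (A - B) (stdOrthonormalBasis ℝ E i) =
    A (stdOrthonormalBasis ℝ E i) - B (stdOrthonormalBasis ℝ E i) from rfl]
  have h1 := norm_sub_le (A (stdOrthonormalBasis ℝ E i)) (B (stdOrthonormalBasis ℝ E i))
  have h2 : ‖A (stdOrthonormalBasis ℝ E i) - B (stdOrthonormalBasis ℝ E i)‖ ^ 2 ≤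
      (‖A (stdOrthonormalBasis ℝ E i)‖ + ‖B (stdOrthonormalBasis ℝ E i)‖) ^ 2 :=
    pow_le_pow_left₀ (norm_nonneg _) h1 2
  nlinarith [h2, sq_nonneg (‖A (stdOrthonormalBasis ℝ E i)‖ - ‖B (stdOrthonormalBasis ℝ E i)‖)]

/-- `|L|²_F ≤ 3 ‖L‖²` for a linear map on `ℝ³` (each of the three columns has norm `≤ ‖L‖`).
[folklore] -/
theorem fastSet_frobeniusNormSq_le_three_mul_sq {F : Type*} [NormedAddCommGroup F]
    [InnerProductSpace ℝ F] (L : EuclideanSpace ℝ (Fin 3) →L[ℝ] F) :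
    frobeniusNormSq L ≤ 3 * ‖L‖ ^ 2 := by
  unfold frobeniusNormSq
  have hcol : ∀ i, ‖L (stdOrthonormalBasis ℝ (EuclideanSpace ℝ (Fin 3)) i)‖ ^ 2 ≤ ‖L‖ ^ 2 := by
    intro i
    refine pow_le_pow_left₀ (norm_nonneg _) ?_ 2
    calc ‖L (stdOrthonormalBasis ℝ (EuclideanSpace ℝ (Fin 3)) i)‖
        ≤ ‖L‖ * ‖stdOrthonormalBasis ℝ (EuclideanSpace ℝ (Fin 3)) i‖ := L.le_opNorm _
      _ = ‖L‖ := by rw [(stdOrthonormalBasis ℝ (EuclideanSpace ℝ (Fin 3))).orthonormal.1 i, mul_one]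
  calc ∑ i, ‖L (stdOrthonormalBasis ℝ (EuclideanSpace ℝ (Fin 3)) i)‖ ^ 2
      ≤ ∑ _i : Fin (Module.finrank ℝ (EuclideanSpace ℝ (Fin 3))), ‖L‖ ^ 2 :=
        Finset.sum_le_sum fun i _ => hcol i
    _ = 3 * ‖L‖ ^ 2 := by
        rw [Finset.sum_const, Finset.card_univ, Fintype.card_fin, finrank_euclideanSpace_fin,
          nsmul_eq_mul]
        norm_num

/-! ### The unit form -/

/-- **Overshoot × Frobenius gradient on the fast set, unit form** (`ν = 1`, speed `≤ 1`): there
are absolute `A ≥ 0`, `ε > 0` such that for every classical solution of the unforced Navier–Stokes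
system on `ℝ³ × [0, b)` with `‖u‖ ≤ 1` on `[0, T] × ℝ³` (`T < b`), `‖u(t)‖_{L²} ≤ K < ∞` there, and
`‖u(0, ·)‖ ≤ B` with `0 < B ≤ 1`: at every time `t ∈ (0, T)` with `t ≤ ε B²` and every fast point
`x` (`‖u(t,x)‖ > B`),

  `(‖u(t,x)‖ - B) · |∇u(t,x)|²_F ≤ A`.

(Overshoot `≤ C₃√t`; caloric Frobenius gradient `≲ 1/√t` at the fast point by the vector
Bernstein inequality and fastness; bounded Duhamel gradient.) [folklore] -/
theorem levelSetModeration_fastSetFrobenius_unit :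
    ∃ A ε : ℝ, 0 ≤ A ∧ 0 < ε ∧ ∀ {b T B : ℝ} {u : ℝ → EuclideanSpace ℝ (Fin 3) → EuclideanSpace ℝ (Fin 3)} {p : ℝ → EuclideanSpace ℝ (Fin 3) → ℝ}, Literature.Analysis.FluidPDE.IsClassicalNSSolutionOn (Set.Ico 0 b) 1 0 u p → 0 < T → T < b → (∀ t ∈ Set.Icc 0 T, ∀ x, ‖u t x‖ ≤ 1) → ∀ {K : ENNReal}, K ≠ ⊤ → (∀ t ∈ Set.Icc 0 T, MeasureTheory.eLpNorm (u t) 2 MeasureTheory.volume ≤ K) → 0 < B → B ≤ 1 → (∀ x, ‖u 0 x‖ ≤ B) → ∀ t ∈ Set.Ioo 0 T, t ≤ ε * B ^ 2 → ∀ x, B < ‖u t x‖ → (‖u t x‖ - B) * Literature.Analysis.FluidPDE.frobeniusNormSq (fderiv ℝ (u t) x) ≤ A := by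
  obtain ⟨C₃, hC₃, hover⟩ := exists_norm_le_initial_add_of_classical_unit
  obtain ⟨CD, hCD, hDuh⟩ := exists_norm_oseenDuhamel_le_mul (E := EuclideanSpace ℝ (Fin 3))
  obtain ⟨P, hP0, hPD⟩ := levelSetModeration_norm_fderiv_oseenDuhamel_le_unit
  set C' : ℝ := C₃ + 2 * CD with hC'
  have hC'0 : 0 < C' := by rw [hC']; positivity
  set A : ℝ := C₃ * (6 * C' + 6 * P ^ 2) with hA
  set ε : ℝ := min 1 (1 / C' ^ 2) with hε
  have hε0 : 0 < ε := lt_min one_pos (by positivity)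
  refine ⟨A, ε, by positivity, hε0, ?_⟩
  intro b T B u p hcl hT hTb hbd K hK hL2 hB hB1 hB0 t ht htε x hfast
  -- the window: `t ≤ B² ≤ 1` and `C'√t ≤ B`
  have htB : t ≤ B ^ 2 := htε.trans ((mul_le_of_le_one_left (sq_nonneg B) (min_le_left _ _)))
  have ht1 : t ≤ 1 := htB.trans (by nlinarith)
  have hC't : C' * Real.sqrt t ≤ B := by
    have h1 : t ≤ 1 / C' ^ 2 * B ^ 2 := htε.trans (mul_le_mul_of_nonneg_right (min_le_right _ _)
      (sq_nonneg B))
    have h2 : C' ^ 2 * t ≤ B ^ 2 := by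
      calc C' ^ 2 * t ≤ C' ^ 2 * (1 / C' ^ 2 * B ^ 2) := mul_le_mul_of_nonneg_left h1 (sq_nonneg _)
        _ = B ^ 2 := by field_simp
    have h3 : Real.sqrt (C' ^ 2 * t) ≤ Real.sqrt (B ^ 2) := Real.sqrt_le_sqrt h2
    rwa [Real.sqrt_mul (sq_nonneg _), Real.sqrt_sq hC'0.le, Real.sqrt_sq hB.le] at h3
  -- times
  set s : ℝ := t / 2 with hs_def
  have hs : 0 < s := by rw [hs_def]; linarith [ht.1]
  have hst : s < t := by rw [hs_def]; linarith [ht.1]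
  have hsT : s < T := hst.trans ht.2
  have hts : t - s = s := by rw [hs_def]; ring
  have hts0 : 0 < t - s := by rw [hts]; exact hs
  have hsqt : 0 < Real.sqrt t := Real.sqrt_pos.2 ht.1
  have hss : Real.sqrt s ≤ Real.sqrt t := Real.sqrt_le_sqrt hst.le
  have htss : Real.sqrt (t - s) ≤ Real.sqrt t := by rw [hts]; exact hss
  -- restrictions of the hypotheses
  have hcl' : IsClassicalNSSolutionOn (Ioo 0 b) 1 0 u p :=
    hcl.mono Ioo_subset_Ico_self (uniqueDiffOn_Ioo 0 b)
  have hbd' : ∀ τ ∈ Ioc 0 T, ∀ y, ‖u τ y‖ ≤ 1 := fun τ hτ y => hbd τ ⟨hτ.1.le, hτ.2⟩ y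
  have hL2' : ∀ τ ∈ Ioc 0 T, eLpNorm (u τ) 2 volume ≤ K := fun τ hτ => hL2 τ ⟨hτ.1.le, hτ.2⟩
  -- (1) the mild formula from `s` at every point
  have hmild : ∀ y, u t y = heatExtension (u s) (t - s) y - oseenDuhamel 1 s u u t y := fun y =>
    mild_of_bounded_of_eLpNorm_two_le_of_lt hcl' hT hTb hbd' hK hL2' hs hst ht.2 y
  -- (2) the overshoot bounds at times `s` and `t`
  set Bs : ℝ := B + C₃ * Real.sqrt s with hBs
  have hBBs : B ≤ Bs := by rw [hBs]; linarith [mul_nonneg hC₃.le (Real.sqrt_nonneg s)]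
  have hus : ∀ y, ‖u s y‖ ≤ Bs := by
    intro y
    have := hover hcl hT hTb hbd hK hL2' hB0 s ⟨hs, hsT⟩ y
    rwa [sub_zero] at this
  have hut_over : ‖u t x‖ - B ≤ C₃ * Real.sqrt t := by
    have := hover hcl hT hTb hbd hK hL2' hB0 t ht x
    rw [sub_zero] at this
    linarith
  -- (3) the Duhamel sup bound
  have hbdI : ∀ τ ∈ Ioo s t, ∀ y, ‖u τ y‖ ≤ 1 := fun τ hτ y =>
    hbd τ ⟨(hs.trans hτ.1).le, (hτ.2.trans ht.2).le⟩ y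
  have hduh : ∀ y, ‖oseenDuhamel 1 s u u t y‖ ≤ 2 * CD * Real.sqrt (t - s) := by
    intro y
    have h := hDuh one_pos hst zero_le_one zero_le_one hbdI hbdI y
    rw [Real.one_rpow] at h
    linarith
  -- (4) the caloric part at the fast point: `Bs² − ‖H x‖² ≤ 3 C' √t`
  set H : EuclideanSpace ℝ (Fin 3) → EuclideanSpace ℝ (Fin 3) := heatExtension (u s) (t - s) with hH
  have hcont_s : Continuous (u s) := (hcl'.contDiff_velocity ⟨hs, hsT.trans hTb⟩).continuous
  have hHx : H x = u t x + oseenDuhamel 1 s u u t x := by rw [hH, hmild x]; abel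
  have hC's : C₃ * Real.sqrt s + 2 * CD * Real.sqrt (t - s) ≤ C' * Real.sqrt t := by
    have := mul_le_mul_of_nonneg_left hss hC₃.le
    have := mul_le_mul_of_nonneg_left htss (by positivity : (0 : ℝ) ≤ 2 * CD)
    rw [hC']; linarith
  have hHlow : B - 2 * CD * Real.sqrt (t - s) ≤ ‖H x‖ := by
    have h1 : ‖u t x‖ ≤ ‖H x‖ + ‖oseenDuhamel 1 s u u t x‖ := by
      calc ‖u t x‖ = ‖H x - oseenDuhamel 1 s u u t x‖ := by rw [hHx]; abel_nf
        _ ≤ ‖H x‖ + ‖oseenDuhamel 1 s u u t x‖ := norm_sub_le _ _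
    linarith [hduh x, hfast.le]
  have hlow0 : 0 ≤ B - 2 * CD * Real.sqrt (t - s) := by
    have : 2 * CD * Real.sqrt (t - s) ≤ C' * Real.sqrt t := by
      have := mul_nonneg hC₃.le (Real.sqrt_nonneg s)
      linarith [hC's]
    linarith [hC't]
  have hdef : Bs ^ 2 - ‖H x‖ ^ 2 ≤ 3 * (C' * Real.sqrt t) := by
    have h1 : (B - 2 * CD * Real.sqrt (t - s)) ^ 2 ≤ ‖H x‖ ^ 2 :=
      pow_le_pow_left₀ hlow0 hHlow 2
    have h2 : Bs ^ 2 - (B - 2 * CD * Real.sqrt (t - s)) ^ 2 =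
        (C₃ * Real.sqrt s + 2 * CD * Real.sqrt (t - s)) *
          (Bs + B - 2 * CD * Real.sqrt (t - s)) := by rw [hBs]; ring
    have h3 : Bs + B - 2 * CD * Real.sqrt (t - s) ≤ 3 := by
      have : C₃ * Real.sqrt s ≤ 1 := by
        have h := mul_nonneg (by positivity : (0:ℝ) ≤ 2 * CD) (Real.sqrt_nonneg (t - s))
        linarith [hC's, hC't]
      have : 0 ≤ 2 * CD * Real.sqrt (t - s) := by positivity
      rw [hBs]; linarith
    have h4 : 0 ≤ C₃ * Real.sqrt s + 2 * CD * Real.sqrt (t - s) := by positivity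
    calc Bs ^ 2 - ‖H x‖ ^ 2 ≤ Bs ^ 2 - (B - 2 * CD * Real.sqrt (t - s)) ^ 2 := by linarith
      _ = (C₃ * Real.sqrt s + 2 * CD * Real.sqrt (t - s)) *
          (Bs + B - 2 * CD * Real.sqrt (t - s)) := h2
      _ ≤ (C' * Real.sqrt t) * 3 := by
          refine mul_le_mul hC's h3 ?_ (by positivity)
          linarith [hlow0, hBBs, hB.le]
      _ = 3 * (C' * Real.sqrt t) := by ring
  -- (5) the vector Bernstein inequality: `t |∇H(x)|²_F = 2(t-s) Σᵢ ‖∂ᵢH(x)‖² ≤ Bs² − ‖H x‖²`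
  have hBern := two_mul_mul_sum_sq_norm_fderiv_heatExtension_le hcont_s hus hts0 x
    (stdOrthonormalBasis ℝ (EuclideanSpace ℝ (Fin 3)))
  have hfrobH : frobeniusNormSq (fderiv ℝ H x) ≤ 3 * C' / Real.sqrt t := by
    have h1 : 2 * (t - s) * frobeniusNormSq (fderiv ℝ H x) ≤ 3 * (C' * Real.sqrt t) := by
      unfold frobeniusNormSq; rw [hH]; exact hBern.trans hdef
    rw [hts, hs_def, show 2 * (t / 2) = t by ring] at h1
    rw [le_div_iff₀ hsqt]
    have h2 : frobeniusNormSq (fderiv ℝ H x) * Real.sqrt t * Real.sqrt t ≤ 3 * C' * Real.sqrt t := by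
      rw [mul_assoc, Real.mul_self_sqrt ht.1.le]; linarith
    have h3 : 0 ≤ frobeniusNormSq (fderiv ℝ H x) :=
      Finset.sum_nonneg fun i _ => sq_nonneg _
    nlinarith [h2, hsqt, h3]
  -- (6) the Duhamel gradient
  obtain ⟨hDd, hDn⟩ := hPD hcl' hT hTb hbd' hK hL2' t ht ht1 x
  have hfrobD : frobeniusNormSq (fderiv ℝ (fun y => oseenDuhamel 1 (t / 2) u u t y) x) ≤ 3 * P ^ 2 :=
    (fastSet_frobeniusNormSq_le_three_mul_sq _).trans (by gcongr)
  -- (7) the derivative of `u t` at `x`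
  have hHd : Differentiable ℝ H := by
    rw [hH]
    exact (contDiff_heatExtension_holds (memLp_top_of_continuous_of_bound hcont_s hus) le_top
      hts0).differentiable (by simp)
  have hfun : u t = fun y => H y - oseenDuhamel 1 (t / 2) u u t y := by
    funext y; rw [hmild y, hH]
  have hDu : fderiv ℝ (u t) x = fderiv ℝ H x - fderiv ℝ (fun y => oseenDuhamel 1 (t / 2) u u t y) x := by
    rw [hfun]
    exact fderiv_fun_sub (hHd x) hDd.differentiableAt
  have hfrob : frobeniusNormSq (fderiv ℝ (u t) x) ≤ 6 * C' / Real.sqrt t + 6 * P ^ 2 := by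
    rw [hDu]
    refine (fastSet_frobeniusNormSq_sub_le _ _).trans ?_
    have : 2 * frobeniusNormSq (fderiv ℝ H x) ≤ 6 * C' / Real.sqrt t := by
      have h := mul_le_mul_of_nonneg_left hfrobH (by norm_num : (0:ℝ) ≤ 2)
      calc 2 * frobeniusNormSq (fderiv ℝ H x) ≤ 2 * (3 * C' / Real.sqrt t) := h
        _ = 6 * C' / Real.sqrt t := by ring
    linarith
  -- (8) the product
  have hfrob0 : 0 ≤ frobeniusNormSq (fderiv ℝ (u t) x) := Finset.sum_nonneg fun i _ => sq_nonneg _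
  calc (‖u t x‖ - B) * frobeniusNormSq (fderiv ℝ (u t) x)
      ≤ (C₃ * Real.sqrt t) * (6 * C' / Real.sqrt t + 6 * P ^ 2) :=
        mul_le_mul hut_over hfrob hfrob0 (by positivity)
    _ = C₃ * (6 * C') + C₃ * (6 * P ^ 2) * Real.sqrt t := by field_simp
    _ ≤ C₃ * (6 * C') + C₃ * (6 * P ^ 2) * 1 := by
        gcongr
        rw [Real.sqrt_le_one]; exact ht1
    _ = A := by rw [hA]; ring

end Summit.NavierStokesRegularity.NavierStokesRegularity.Theorems

end
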